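import Summits.HodgeConjecture.CorCM.Hyp21.S5cPrimeOfQ5
import Literature.AlgebraicGeometry.Motives.AbelianSchemeModelTwistedReductionTateHolds
import HarnessLib

/-!
# `S5c′` is a THEOREM (cell `hodgecm-mathlib`, row II-1, edition E4 «S5c′ ↦ Q5 ↦ ∅»)

`S5c′` = `AbelianVariety.exists_finite_forall_exists_goodReductionAt_homReduction_conjFrob_isTateCompatible` (the merged produced-currency
edition of [Shimura1998] §11.1 Prop. 12/14 (i) + §18.6 p. 129, typed ★ p618079; the `hRHS5c` binder of `hc_cm_of_floor_v5`, the
`stub_factRHS5c` of `Cruxes/H21/Lines/a2_casselman_descent.lean`, `FactRHS5c` of `b2_main_theorem_cm`) — PROVED OUTRIGHT: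
the bridge `Hyp21.factRHS5c_of_Q5` (B-typ04 ★ p622510, = the assembly ★ p620235 `…_isTateCompatible_of_twistedReduction` at the
named Q5) applied to `IsAbelianSchemeModel.forall_isTateCompatible_homReduction_conjFrob_tateSpecialisation_holds` (Q5 PROVED,
`Literature/AlgebraicGeometry/Motives/AbelianSchemeModelTwistedReductionTateHolds.lean`).  THEOREMS ONLY; `--supports
stmt-HodgeConjecture-24834`; closer B-p20 (B-p09 RULING 4 (4)).  Consumers by name: floor edition «−Q5» (count −1), a2 `stub_factRHS5c` (this file's first theorem carries
the registered stub's name and signature verbatim), b2 `factQ5_holds`.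
HC_CM is proved only modulo the printed citations until rung 0 closes.
-/

set_option autoImplicit false

noncomputable section

open Literature.NumberTheory.DiophantineGeometry Literature.AlgebraicGeometry.Motives

namespace Summit.HodgeConjecture.CorCM.Hyp21

open Literature.AlgebraicGeometry.Motives.AbelianVariety

/-- **`S5c′` holds — the registered printed-fact stub `stub_factRHS5c` of `Cruxes/H21/Lines/a2_casselman_descent.lean` (pen
stmt-HodgeConjecture-24834, v11–v13), CLOSED with its signature VERBATIM**: cofinitely in `v`, produced good-reduction data of a finite
family with pairwise `HomReduction`s, and for every arithmetic Frobenius `γ` at `v` the companions of the Frobenius conjugate, a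
Frobenius `σ̃` over `γ`, produced and transported specialisation data with one common prime, Prop. 14 (i) for produced pairs, Q5 for the
companions, and clause (2′) — ALL clauses are tree theorems now: the bridge `factRHS5c_of_Q5` (★ p622510, = the assembly ★ p620235) at
Q5 PROVED (`IsAbelianSchemeModel.forall_isTateCompatible_homReduction_conjFrob_tateSpecialisation_holds`).
[cite: Shimura1998, §11.1 Prop. 12 and Prop. 14 (i); §18.6 proof of Thm. 18.6 (pp. 128–130)] [cite: SerreTate1968, §1 Lemma 2 and Thm. 1] -/
theorem stub_factRHS5c : exists_finite_forall_exists_goodReductionAt_homReduction_conjFrob_isTateCompatible :=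
  factRHS5c_of_Q5 IsAbelianSchemeModel.forall_isTateCompatible_homReduction_conjFrob_tateSpecialisation_holds

/-- **`S5c′` holds**, under the cell's by-name spelling (floor editions `hRHS5c`, b2 `FactRHS5c`): the same term.
[cite: Shimura1998, §11.1 Prop. 14 (i); §18.6 proof of Thm. 18.6 (pp. 128–130)] -/
theorem factRHS5c_holds :
    AbelianVariety.exists_finite_forall_exists_goodReductionAt_homReduction_conjFrob_isTateCompatible :=
  stub_factRHS5c

end Summit.HodgeConjecture.CorCM.Hyp21

end
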